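import Literature.NumberTheory.Rogawski1990.TamagawaSingularCovolTowerPartnerRescaled       -- ★ (W9) J2a `covolTower_of_partner_eq` (+ ★ J1 p844899, ★ p844690 Covol, ★ p844223 FinTF)
import Literature.NumberTheory.Rogawski1990.ArchCanonicalSingularHaar                    -- ★ `isHaarMeasure_of_archCanonicalSingularMatrix` (`νGi` is Haar under `hACS`)
import Literature.NumberTheory.Automorphic.UnitaryGroupCovolWeightStable                   -- ★ `countable_quotientSubgroup_inf_centralizer_subgroupOf`
import Literature.NumberTheory.Automorphic.OrbitalMeasureQuotientOfPointHaarChange         -- ★ `quotientMeasure_nnreal_smul_haar`, `isInvInvariant_nnreal_smul`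
import HarnessLib

/-!
# ROAD F′ (W9), FILE J2 — THE JUNCTION «S1finTF ⟸ COVOL»: `TamagawaSingularMembersFinTFCovol ⟹ TamagawaSingularMembersFinTF` at a frame with level-normalised
# local Haar data (Rogawski 1990 §14.5 Lemma 14.5.2 (b) pp. 238–239, §1.7 p. 6; Kottwitz 1988 Prop. 2)

Topic `NumberTheory/Rogawski1990`; namespace `Literature.NumberTheory.Rogawski1990`.  THEOREMS ONLY (no `def`, no instance, no notation, no named fact, no `sorry`).
Cell `pub/hodgecm-mathlib`, crux H413 = stmt-HodgeConjecture-24833; ROAD F′ (LEAD F0P3a-plan (g10) T9-40 (d3); owner F0P3a-p07 (g10) SPEC (W9) 4a4af3d0d52254ea, step 4);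
F0P3-p02 (g13).  Count-neutral (the closer edition «S1finTF ⟸ COVOL» re-denominates books row «S1′-fin-TF» as ★ p844690's covolume text).  HONEST LABEL: HC_CM is proved only
modulo the printed citations until rung 0 closes.

WHAT.  ★ `TamagawaSingularMembersFinTFCovol` (p844690) is ★ `TamagawaSingularMembersFinTF` (p844223) with (K7-s) («for every Haar partner family `νZ` of `ofLocal mGs TF`
against `νA`, covolumes agree on stably conjugate singular non-central classes») replaced by print's bare covolume constancy (T′) for the SPELLED Tamagawa-type towers,
plus (COH-fin) and the binder `hK`.  THIS FILE proves the implication back, frame by frame: given `hK : νG_v(U(H′)(𝒪_v)) = 1` and the Covol letter, the FinTF letter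
holds for every adelic Haar measure `νA`.  (Q-fin), (C1)-fin, (NORM), κ-block pass through; for (K7-s): fix a reference decomposition `νA = e_* (νi₁ ⊗ ν_f)` (★
`UnitaryGroup.exists_isHaarMeasure_arch_eq_map_prod_rpMeasure`) and `κ := haarScalarFactor νi₁ νGi`; by ★ J2a `covolTower_of_partner_eq` the family `κ⁻¹ • νZ` satisfies
(T′)'s antecedent at every singular non-central class, so (T′) gives `vol(·; κ⁻¹ • νZ c) = vol(·; κ⁻¹ • νZ c′)`, and `κ⁻¹` cancels (★ `quotientMeasure_nnreal_smul_haar`; the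
rational centraliser lattices are countable).  Print: [Rogawski1990 §14.5 p. 239 «`m(Z G′_{γ^δ}∖G′_{γ^δ}) = m(Z_H∖H)`»; Kottwitz1988 Prop. 2; §1.7 p. 6 «compatible measures»].

* **`tamagawaSingularMembersFinTF_of_finTFCovol (hK) (h : TamagawaSingularMembersFinTFCovol …) : TamagawaSingularMembersFinTF … νA`** (frame level; the CLOSED form
  waits for the desk's word on how the closer supplies `hK` — SPEC (W9)'s open typing question).

## References
* [Rogawski1990] J. D. Rogawski, *Automorphic Representations of Unitary Groups in Three Variables*, Ann. of Math. Stud. 123 (1990), §1.7 p. 6, p. 11; §4.3 pp. 43–44; §5.4 p. 72;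
  §14.5 Lemma 14.5.2 (b) pp. 238–239.
* [Kottwitz1988] R. E. Kottwitz, *Tamagawa numbers*, Ann. of Math. 127 (1988), Thm. 1, Prop. 2.
* [DeitmarEchterhoff2014] A. Deitmar, S. Echterhoff, *Principles of Harmonic Analysis*, 2nd ed. (2014), Thm. 1.5.3.
* [Gelbart1975] S. Gelbart, *Automorphic forms on adele groups* (1975), Remark 9.23, p. 155 (10.19).
-/

set_option autoImplicit false

noncomputable section

open MeasureTheory Measure NumberField IsDedekindDomain
open Literature.MeasureTheory.Group Literature.MeasureTheory.RestrictedProduct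
open Literature.Topology.RestrictedProduct Literature.Topology.Algebra.RestrictedProduct
open Literature.NumberTheory.Automorphic
open Literature.AlgebraicGeometry.ShimuraVarieties (unitaryGroup hermForm)
open scoped Matrix MatrixGroups RestrictedProduct NNReal ENNReal

namespace Literature.NumberTheory.Rogawski1990

section Frame

variable (L : Type) [Field L] [NumberField L] [IsCMField L]

variable (H' : Matrix (Fin 3) (Fin 3) L) (Tinf : ArchTransferFactor L H')
    -- σ-algebras of the `G′` side (★ (O10-c5) block), of `H_v`, `G_∞`, `H_∞`, and the Haar data — EXACTLY ★ `SingularEllipticTransfer`'s binders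
    [∀ g : (UnitaryGroup.cmDatum L 3 H').Adelic, MeasurableSpace ((UnitaryGroup.cmDatum L 3 H').Adelic ⧸ Subgroup.centralizer ({g} : Set (UnitaryGroup.cmDatum L 3 H').Adelic))]
    [∀ g : (UnitaryGroup.cmDatum L 3 H').Adelic, BorelSpace ((UnitaryGroup.cmDatum L 3 H').Adelic ⧸ Subgroup.centralizer ({g} : Set (UnitaryGroup.cmDatum L 3 H').Adelic))]
    [∀ γ : UnitaryGroup.arch (↥(maximalRealSubfield L)) L (IsCMField.complexConj L) 3 H',
      MeasurableSpace (UnitaryGroup.arch (↥(maximalRealSubfield L)) L (IsCMField.complexConj L) 3 H' ⧸ Subgroup.centralizer ({γ} : Set (UnitaryGroup.arch (↥(maximalRealSubfield L)) L (IsCMField.complexConj L) 3 H')))]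
    [∀ γ : UnitaryGroup.arch (↥(maximalRealSubfield L)) L (IsCMField.complexConj L) 3 H',
      BorelSpace (UnitaryGroup.arch (↥(maximalRealSubfield L)) L (IsCMField.complexConj L) 3 H' ⧸ Subgroup.centralizer ({γ} : Set (UnitaryGroup.arch (↥(maximalRealSubfield L)) L (IsCMField.complexConj L) 3 H')))]
    [∀ (v : HeightOneSpectrum (𝓞 ↥(maximalRealSubfield L))) (γ : (UnitaryGroup.cmDatum L 3 H').Local v),
      MeasurableSpace ((UnitaryGroup.cmDatum L 3 H').Local v ⧸ Subgroup.centralizer ({γ} : Set ((UnitaryGroup.cmDatum L 3 H').Local v)))]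
    [∀ (v : HeightOneSpectrum (𝓞 ↥(maximalRealSubfield L))) (γ : (UnitaryGroup.cmDatum L 3 H').Local v),
      BorelSpace ((UnitaryGroup.cmDatum L 3 H').Local v ⧸ Subgroup.centralizer ({γ} : Set ((UnitaryGroup.cmDatum L 3 H').Local v)))]
    [∀ v : HeightOneSpectrum (𝓞 ↥(maximalRealSubfield L)), MeasurableSpace ((UnitaryGroup.cmDatum L 3 H').Local v)] [∀ v : HeightOneSpectrum (𝓞 ↥(maximalRealSubfield L)), BorelSpace ((UnitaryGroup.cmDatum L 3 H').Local v)]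
    [MeasurableSpace (UnitaryGroup.cmDatum L 3 H').Adelic] [BorelSpace (UnitaryGroup.cmDatum L 3 H').Adelic]
    [MeasurableSpace (UnitaryGroup.arch (↥(maximalRealSubfield L)) L (IsCMField.complexConj L) 3 H')] [BorelSpace (UnitaryGroup.arch (↥(maximalRealSubfield L)) L (IsCMField.complexConj L) 3 H')]
    [∀ γ : (UnitaryGroup.cmDatum L 3 H').Adelic, MeasurableSpace (↥(Subgroup.centralizer ({γ} : Set (UnitaryGroup.cmDatum L 3 H').Adelic)) ⧸
      ((UnitaryGroup.cmDatum L 3 H').quotientSubgroup ⊓ Subgroup.centralizer ({γ} : Set (UnitaryGroup.cmDatum L 3 H').Adelic)).subgroupOf (Subgroup.centralizer ({γ} : Set (UnitaryGroup.cmDatum L 3 H').Adelic)))]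
    [∀ γ : (UnitaryGroup.cmDatum L 3 H').Adelic, BorelSpace (↥(Subgroup.centralizer ({γ} : Set (UnitaryGroup.cmDatum L 3 H').Adelic)) ⧸
      ((UnitaryGroup.cmDatum L 3 H').quotientSubgroup ⊓ Subgroup.centralizer ({γ} : Set (UnitaryGroup.cmDatum L 3 H').Adelic)).subgroupOf (Subgroup.centralizer ({γ} : Set (UnitaryGroup.cmDatum L 3 H').Adelic)))]
    [hCcl : ∀ γ : (UnitaryGroup.cmDatum L 3 H').Adelic, IsClosed ((Subgroup.centralizer ({γ} : Set (UnitaryGroup.cmDatum L 3 H').Adelic) : Subgroup (UnitaryGroup.cmDatum L 3 H').Adelic) : Set (UnitaryGroup.cmDatum L 3 H').Adelic)]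
    [∀ γ : (UnitaryGroup.cmDatum L 3 H').Adelic, (count : Measure ↥(((UnitaryGroup.cmDatum L 3 H').quotientSubgroup ⊓ Subgroup.centralizer ({γ} : Set (UnitaryGroup.cmDatum L 3 H').Adelic)).subgroupOf
      (Subgroup.centralizer ({γ} : Set (UnitaryGroup.cmDatum L 3 H').Adelic)))).IsHaarMeasure]
    [∀ v : HeightOneSpectrum (𝓞 ↥(maximalRealSubfield L)), MeasurableSpace ((UnitaryGroup.cmDatum L 2 (Matrix.of fun i j : Fin 2 => if i.val + j.val + 1 = 2 then (1 : L) else 0)).Local v ×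
        (UnitaryGroup.cmDatum L 1 (Matrix.of fun i j : Fin 1 => if i.val + j.val + 1 = 1 then (1 : L) else 0)).Local v)]
    [∀ v : HeightOneSpectrum (𝓞 ↥(maximalRealSubfield L)), BorelSpace ((UnitaryGroup.cmDatum L 2 (Matrix.of fun i j : Fin 2 => if i.val + j.val + 1 = 2 then (1 : L) else 0)).Local v ×
        (UnitaryGroup.cmDatum L 1 (Matrix.of fun i j : Fin 1 => if i.val + j.val + 1 = 1 then (1 : L) else 0)).Local v)]
    [∀ (v : HeightOneSpectrum (𝓞 ↥(maximalRealSubfield L))) (a : ((UnitaryGroup.cmDatum L 2 (Matrix.of fun i j : Fin 2 => if i.val + j.val + 1 = 2 then (1 : L) else 0)).Local v ×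
        (UnitaryGroup.cmDatum L 1 (Matrix.of fun i j : Fin 1 => if i.val + j.val + 1 = 1 then (1 : L) else 0)).Local v)),
      MeasurableSpace (((UnitaryGroup.cmDatum L 2 (Matrix.of fun i j : Fin 2 => if i.val + j.val + 1 = 2 then (1 : L) else 0)).Local v ×
        (UnitaryGroup.cmDatum L 1 (Matrix.of fun i j : Fin 1 => if i.val + j.val + 1 = 1 then (1 : L) else 0)).Local v) ⧸ Subgroup.centralizer ({a} : Set ((UnitaryGroup.cmDatum L 2 (Matrix.of fun i j : Fin 2 => if i.val + j.val + 1 = 2 then (1 : L) else 0)).Local v ×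
        (UnitaryGroup.cmDatum L 1 (Matrix.of fun i j : Fin 1 => if i.val + j.val + 1 = 1 then (1 : L) else 0)).Local v)))]
    [∀ (v : HeightOneSpectrum (𝓞 ↥(maximalRealSubfield L))) (a : ((UnitaryGroup.cmDatum L 2 (Matrix.of fun i j : Fin 2 => if i.val + j.val + 1 = 2 then (1 : L) else 0)).Local v ×
        (UnitaryGroup.cmDatum L 1 (Matrix.of fun i j : Fin 1 => if i.val + j.val + 1 = 1 then (1 : L) else 0)).Local v)),
      BorelSpace (((UnitaryGroup.cmDatum L 2 (Matrix.of fun i j : Fin 2 => if i.val + j.val + 1 = 2 then (1 : L) else 0)).Local v ×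
        (UnitaryGroup.cmDatum L 1 (Matrix.of fun i j : Fin 1 => if i.val + j.val + 1 = 1 then (1 : L) else 0)).Local v) ⧸ Subgroup.centralizer ({a} : Set ((UnitaryGroup.cmDatum L 2 (Matrix.of fun i j : Fin 2 => if i.val + j.val + 1 = 2 then (1 : L) else 0)).Local v ×
        (UnitaryGroup.cmDatum L 1 (Matrix.of fun i j : Fin 1 => if i.val + j.val + 1 = 1 then (1 : L) else 0)).Local v)))]
    [MeasurableSpace (UnitaryGroup.arch (↥(maximalRealSubfield L)) L (IsCMField.complexConj L) 3 (Matrix.of fun i j : Fin 3 => if i.val + j.val + 1 = 3 then (1 : L) else 0))] [BorelSpace (UnitaryGroup.arch (↥(maximalRealSubfield L)) L (IsCMField.complexConj L) 3 (Matrix.of fun i j : Fin 3 => if i.val + j.val + 1 = 3 then (1 : L) else 0))]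
    [∀ γ : UnitaryGroup.arch (↥(maximalRealSubfield L)) L (IsCMField.complexConj L) 3 (Matrix.of fun i j : Fin 3 => if i.val + j.val + 1 = 3 then (1 : L) else 0),
      MeasurableSpace (UnitaryGroup.arch (↥(maximalRealSubfield L)) L (IsCMField.complexConj L) 3 (Matrix.of fun i j : Fin 3 => if i.val + j.val + 1 = 3 then (1 : L) else 0) ⧸ Subgroup.centralizer ({γ} : Set (UnitaryGroup.arch (↥(maximalRealSubfield L)) L (IsCMField.complexConj L) 3 (Matrix.of fun i j : Fin 3 => if i.val + j.val + 1 = 3 then (1 : L) else 0))))]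
    [∀ γ : UnitaryGroup.arch (↥(maximalRealSubfield L)) L (IsCMField.complexConj L) 3 (Matrix.of fun i j : Fin 3 => if i.val + j.val + 1 = 3 then (1 : L) else 0),
      BorelSpace (UnitaryGroup.arch (↥(maximalRealSubfield L)) L (IsCMField.complexConj L) 3 (Matrix.of fun i j : Fin 3 => if i.val + j.val + 1 = 3 then (1 : L) else 0) ⧸ Subgroup.centralizer ({γ} : Set (UnitaryGroup.arch (↥(maximalRealSubfield L)) L (IsCMField.complexConj L) 3 (Matrix.of fun i j : Fin 3 => if i.val + j.val + 1 = 3 then (1 : L) else 0))))]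
    [MeasurableSpace (UnitaryGroup.arch (↥(maximalRealSubfield L)) L (IsCMField.complexConj L) 2 (Matrix.of fun i j : Fin 2 => if i.val + j.val + 1 = 2 then (1 : L) else 0) ×
          UnitaryGroup.arch (↥(maximalRealSubfield L)) L (IsCMField.complexConj L) 1 (Matrix.of fun i j : Fin 1 => if i.val + j.val + 1 = 1 then (1 : L) else 0))]
    [BorelSpace (UnitaryGroup.arch (↥(maximalRealSubfield L)) L (IsCMField.complexConj L) 2 (Matrix.of fun i j : Fin 2 => if i.val + j.val + 1 = 2 then (1 : L) else 0) ×
          UnitaryGroup.arch (↥(maximalRealSubfield L)) L (IsCMField.complexConj L) 1 (Matrix.of fun i j : Fin 1 => if i.val + j.val + 1 = 1 then (1 : L) else 0))]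
    [∀ a : (UnitaryGroup.arch (↥(maximalRealSubfield L)) L (IsCMField.complexConj L) 2 (Matrix.of fun i j : Fin 2 => if i.val + j.val + 1 = 2 then (1 : L) else 0) ×
          UnitaryGroup.arch (↥(maximalRealSubfield L)) L (IsCMField.complexConj L) 1 (Matrix.of fun i j : Fin 1 => if i.val + j.val + 1 = 1 then (1 : L) else 0)),
      MeasurableSpace ((UnitaryGroup.arch (↥(maximalRealSubfield L)) L (IsCMField.complexConj L) 2 (Matrix.of fun i j : Fin 2 => if i.val + j.val + 1 = 2 then (1 : L) else 0) ×
          UnitaryGroup.arch (↥(maximalRealSubfield L)) L (IsCMField.complexConj L) 1 (Matrix.of fun i j : Fin 1 => if i.val + j.val + 1 = 1 then (1 : L) else 0)) ⧸ Subgroup.centralizer ({a} : Set (UnitaryGroup.arch (↥(maximalRealSubfield L)) L (IsCMField.complexConj L) 2 (Matrix.of fun i j : Fin 2 => if i.val + j.val + 1 = 2 then (1 : L) else 0) ×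
          UnitaryGroup.arch (↥(maximalRealSubfield L)) L (IsCMField.complexConj L) 1 (Matrix.of fun i j : Fin 1 => if i.val + j.val + 1 = 1 then (1 : L) else 0))))]
    [∀ a : (UnitaryGroup.arch (↥(maximalRealSubfield L)) L (IsCMField.complexConj L) 2 (Matrix.of fun i j : Fin 2 => if i.val + j.val + 1 = 2 then (1 : L) else 0) ×
          UnitaryGroup.arch (↥(maximalRealSubfield L)) L (IsCMField.complexConj L) 1 (Matrix.of fun i j : Fin 1 => if i.val + j.val + 1 = 1 then (1 : L) else 0)),
      BorelSpace ((UnitaryGroup.arch (↥(maximalRealSubfield L)) L (IsCMField.complexConj L) 2 (Matrix.of fun i j : Fin 2 => if i.val + j.val + 1 = 2 then (1 : L) else 0) ×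
          UnitaryGroup.arch (↥(maximalRealSubfield L)) L (IsCMField.complexConj L) 1 (Matrix.of fun i j : Fin 1 => if i.val + j.val + 1 = 1 then (1 : L) else 0)) ⧸ Subgroup.centralizer ({a} : Set (UnitaryGroup.arch (↥(maximalRealSubfield L)) L (IsCMField.complexConj L) 2 (Matrix.of fun i j : Fin 2 => if i.val + j.val + 1 = 2 then (1 : L) else 0) ×
          UnitaryGroup.arch (↥(maximalRealSubfield L)) L (IsCMField.complexConj L) 1 (Matrix.of fun i j : Fin 1 => if i.val + j.val + 1 = 1 then (1 : L) else 0))))]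
    (νH : ∀ v : HeightOneSpectrum (𝓞 ↥(maximalRealSubfield L)), Measure ((UnitaryGroup.cmDatum L 2 (Matrix.of fun i j : Fin 2 => if i.val + j.val + 1 = 2 then (1 : L) else 0)).Local v ×
        (UnitaryGroup.cmDatum L 1 (Matrix.of fun i j : Fin 1 => if i.val + j.val + 1 = 1 then (1 : L) else 0)).Local v))
    (νG : ∀ v : HeightOneSpectrum (𝓞 ↥(maximalRealSubfield L)), Measure ((UnitaryGroup.cmDatum L 3 H').Local v))
    [∀ v, IsFiniteMeasureOnCompacts (νH v)] [∀ v, (νH v).IsMulRightInvariant]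
    [∀ v, (νG v).IsHaarMeasure] [∀ v, (νG v).IsMulRightInvariant]  -- MAIN-b's strength (F2): `νG_v` Haar
    (νGi : Measure (UnitaryGroup.arch (↥(maximalRealSubfield L)) L (IsCMField.complexConj L) 3 H')) (νqi : Measure (UnitaryGroup.arch (↥(maximalRealSubfield L)) L (IsCMField.complexConj L) 3 (Matrix.of fun i j : Fin 3 => if i.val + j.val + 1 = 3 then (1 : L) else 0)))
    (νHi : Measure (UnitaryGroup.arch (↥(maximalRealSubfield L)) L (IsCMField.complexConj L) 2 (Matrix.of fun i j : Fin 2 => if i.val + j.val + 1 = 2 then (1 : L) else 0) ×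
          UnitaryGroup.arch (↥(maximalRealSubfield L)) L (IsCMField.complexConj L) 1 (Matrix.of fun i j : Fin 1 => if i.val + j.val + 1 = 1 then (1 : L) else 0)))
    [IsFiniteMeasureOnCompacts νGi] [νGi.IsMulRightInvariant] [IsFiniteMeasureOnCompacts νqi] [νqi.IsMulRightInvariant]
    [IsFiniteMeasureOnCompacts νHi] [νHi.IsMulRightInvariant]
    (νA : Measure (UnitaryGroup.cmDatum L 3 H').Adelic) [νA.IsHaarMeasure] [νA.IsMulRightInvariant]

set_option maxHeartbeats 16000000 in
set_option synthInstance.maxHeartbeats 800000 in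
-- HB: (T′)'s instantiation and ★ J2a's on the concrete `cmDatum` ∕ restricted-product carriers (★ O10-s's own budget)
/-- **(W9) THE JUNCTION «S1finTF ⟸ COVOL» AT A FRAME.**  For the S1′ frame (★ `TamagawaSingularMembersFinTF`'s binders verbatim) whose local Haar data are
level-normalised (`hK : νG_v(U(H′)(𝒪_v)) = 1`, MAIN-b's `IsProductHaar` conjunct), ★ `TamagawaSingularMembersFinTFCovol L H′ Tinf νH νG νGi νqi νHi` implies
★ `TamagawaSingularMembersFinTF L H′ Tinf νH νG νGi νqi νHi νA` for every adelic Haar measure `νA`: (Q-fin), (C1)-fin, (NORM), κ-block-TF pass through, and (K7-s)-TF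
follows from (T′) applied to the rescaled partner family `κ⁻¹ • νZ` (`κ = haarScalarFactor νi₁ νGi` for a reference archimedean Haar measure `νi₁` with
`νA = e_* (νi₁ ⊗ ν_f)`; at each singular non-central class `νZ d = κ •` the (T′) tower, ★ `covolTower_of_partner_eq`), the common factor cancelling in the covolumes.
[cite: Rogawski1990, §14.5 Lemma 14.5.2 (b) pp. 238–239; §1.7 p. 6, p. 11; §4.3 pp. 43–44; §5.4 p. 72] [cite: Kottwitz1988, Thm. 1, Prop. 2] [cite: DeitmarEchterhoff2014, Thm. 1.5.3]
[cite: Gelbart1975, Remark 9.23] -/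
theorem tamagawaSingularMembersFinTF_of_finTFCovol
    (hK : ∀ v : HeightOneSpectrum (𝓞 ↥(maximalRealSubfield L)), νG v (UnitaryGroup.cmLocalIntegralLevel L 3 H' v : Set ((UnitaryGroup.cmDatum L 3 H').Local v)) = 1)
    (h : TamagawaSingularMembersFinTFCovol L H' Tinf νH νG νGi νqi νHi) :
    TamagawaSingularMembersFinTF L H' Tinf νH νG νGi νqi νHi νA := by
  intro hanis Sbad Δ mH mG m' m mHi t' t tH hherm hCTM hACS
  obtain ⟨mGs, tGs, hQfin, hCOH, hC1, hNORM, hT', hκ⟩ := h hK hanis Sbad Δ mH mG m' m mHi t' t tH hherm hCTM hACS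
  refine ⟨mGs, ⟨tGs, hQfin⟩, hC1, hNORM, ?_, hκ⟩
  -- (K7-s)-TF
  intro νZ hZH hZR hZI hq c c' hreg hcen hreg' hcen' hst
  classical
  haveI : νGi.IsHaarMeasure := isHaarMeasure_of_archCanonicalSingularMatrix L H' Tinf νGi νqi νHi hanis m' m mHi t' t tH hherm hACS
  -- the model-side σ-algebras (Borel) and the model identifications bound as DATA with equations (★ (O10-c4-b)'s idiom)
  letI : ∀ v, MeasurableSpace ↥(UnitaryGroup.localPi L (IsCMField.complexConj L) 3 H' v) := fun _ => borel _
  haveI : ∀ v, BorelSpace ↥(UnitaryGroup.localPi L (IsCMField.complexConj L) 3 H' v) := fun _ => ⟨rfl⟩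
  letI : MeasurableSpace (UnitaryGroup.finAdelic (↥(maximalRealSubfield L)) L (IsCMField.complexConj L) 3 H') := borel _
  haveI : BorelSpace (UnitaryGroup.finAdelic (↥(maximalRealSubfield L)) L (IsCMField.complexConj L) 3 H') := ⟨rfl⟩
  obtain ⟨ψ, hψ⟩ : ∃ ψ : ∀ v, ↥(UnitaryGroup.localPi L (IsCMField.complexConj L) 3 H' v) ≃ₜ* (UnitaryGroup.cmDatum L 3 H').Local v,
      ψ = fun v => UnitaryGroup.localPiEquiv L (IsCMField.complexConj L) 3 H' v := ⟨_, rfl⟩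
  obtain ⟨e, he'⟩ : ∃ e : (UnitaryGroup.arch (↥(maximalRealSubfield L)) L (IsCMField.complexConj L) 3 H') × (UnitaryGroup.finAdelic (↥(maximalRealSubfield L)) L (IsCMField.complexConj L) 3 H') ≃* (UnitaryGroup.cmDatum L 3 H').Adelic,
      e = (UnitaryGroup.adelicProdEquiv (↥(maximalRealSubfield L)) L (IsCMField.complexConj L) 3 H').symm.toMulEquiv := ⟨_, rfl⟩
  have he : Continuous e := by rw [he']; exact (UnitaryGroup.adelicProdEquiv (↥(maximalRealSubfield L)) L (IsCMField.complexConj L) 3 H').symm.continuous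
  have hes : Continuous e.symm := by rw [he']; exact (UnitaryGroup.adelicProdEquiv (↥(maximalRealSubfield L)) L (IsCMField.complexConj L) 3 H').continuous
  have hg : ∀ g : (UnitaryGroup.cmDatum L 3 H').Adelic, e (UnitaryGroup.archPart (↥(maximalRealSubfield L)) L (IsCMField.complexConj L) 3 H' g, UnitaryGroup.finPart (↥(maximalRealSubfield L)) L (IsCMField.complexConj L) 3 H' g) = g := fun g => by
    rw [he']; exact UnitaryGroup.adelicProdEquiv_symm_archPart_finPart L 3 H' g
  -- §1 a reference decomposition `νA = e_* (νi₁ ⊗ ν_f(∅))` (★ C-glob) and the scalar `κ = haarScalarFactor νi₁ νGi`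
  have hν1 : ∀ v, (Measure.map (ψ v).symm (νG v)) (UnitaryGroup.localInt L (IsCMField.complexConj L) 3 H' v : Set ↥(UnitaryGroup.localPi L (IsCMField.complexConj L) 3 H' v)) = 1 :=
    fun v => UnitaryGroup.map_localPiEquiv_symm_apply_localInt_eq_one v (ψ v) (congrFun hψ v) (νG v) (hK v)
  haveI hν'H : ∀ v, IsHaarMeasure (Measure.map (ψ v).symm (νG v)) := fun v => UnitaryGroup.isHaarMeasure_map_localModel_symm v (ψ v) (νG v)
  obtain ⟨νi₁, hνiH₁, hνA₁⟩ := UnitaryGroup.exists_isHaarMeasure_arch_eq_map_prod_rpMeasure (fun v => (Measure.map (ψ v).symm (νG v))) ∅ (fun v _ => hν1 v) νA e he'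
  haveI := hνiH₁
  have hκ0 : Measure.haarScalarFactor νi₁ νGi ≠ 0 := (Measure.haarScalarFactor_pos_of_isHaarMeasure νi₁ νGi).ne'
  have hκi0 : (Measure.haarScalarFactor νi₁ νGi)⁻¹ ≠ 0 := inv_ne_zero hκ0
  -- §2 the rescaled partner family `κ⁻¹ • νZ` satisfies (T′)'s antecedent (★ J2a at every singular non-central class, (NORM) supplying the exceptional set)
  haveI hH' : ∀ d, IsHaarMeasure (((Measure.haarScalarFactor νi₁ νGi)⁻¹ • νZ d : Measure _)) := fun d => IsHaarMeasure.nnreal_smul (νZ d) hκi0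
  haveI hR' : ∀ d, (((Measure.haarScalarFactor νi₁ νGi)⁻¹ • νZ d : Measure _)).IsMulRightInvariant := fun d => inferInstance
  haveI hI' : ∀ d, (((Measure.haarScalarFactor νi₁ νGi)⁻¹ • νZ d : Measure _)).IsInvInvariant := fun d => isInvInvariant_nnreal_smul (νZ d) _
  have main := hT' ψ hψ e he' he hes hg (fun d => ((Measure.haarScalarFactor νi₁ νGi)⁻¹ • νZ d : Measure _)) hH' hR' hI'
    (fun d hdreg hdcen => (hNORM (Quotient.out d) hdreg).elim fun S_d hS_d =>
      ⟨S_d, hS_d, covolTower_of_partner_eq L H' hanis hherm νG hK mGs tGs hQfin hCOH νGi νA ψ hψ e he' he hes hg νi₁ ∅ hνA₁ d hdreg hdcen S_d hS_d (νZ d) (hq d hdreg hdcen)⟩)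
    c c' hreg hcen hreg' hcen' hst
  -- §3 cancel `κ⁻¹` in the covolumes (the rational centraliser lattices are countable, so `count` is s-finite)
  haveI := UnitaryGroup.countable_quotientSubgroup_inf_centralizer_subgroupOf L 3 H' ((UnitaryGroup.cmDatum L 3 H').toAdelic (Quotient.out c))
  haveI := UnitaryGroup.countable_quotientSubgroup_inf_centralizer_subgroupOf L 3 H' ((UnitaryGroup.cmDatum L 3 H').toAdelic (Quotient.out c'))
  rw [quotientMeasure_nnreal_smul_haar (hZ := isClosed_subgroupOf _ _ ((UnitaryGroup.isClosed_cmDatum_quotientSubgroup L 3 H').inter (hCcl _)))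
      (((UnitaryGroup.cmDatum L 3 H').quotientSubgroup ⊓ Subgroup.centralizer ({(UnitaryGroup.cmDatum L 3 H').toAdelic (Quotient.out c)} : Set (UnitaryGroup.cmDatum L 3 H').Adelic)).subgroupOf (Subgroup.centralizer ({(UnitaryGroup.cmDatum L 3 H').toAdelic (Quotient.out c)} : Set (UnitaryGroup.cmDatum L 3 H').Adelic))) count (νZ c) (Measure.haarScalarFactor νi₁ νGi)⁻¹ hκi0,
    quotientMeasure_nnreal_smul_haar (hZ := isClosed_subgroupOf _ _ ((UnitaryGroup.isClosed_cmDatum_quotientSubgroup L 3 H').inter (hCcl _)))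
      (((UnitaryGroup.cmDatum L 3 H').quotientSubgroup ⊓ Subgroup.centralizer ({(UnitaryGroup.cmDatum L 3 H').toAdelic (Quotient.out c')} : Set (UnitaryGroup.cmDatum L 3 H').Adelic)).subgroupOf (Subgroup.centralizer ({(UnitaryGroup.cmDatum L 3 H').toAdelic (Quotient.out c')} : Set (UnitaryGroup.cmDatum L 3 H').Adelic))) count (νZ c') (Measure.haarScalarFactor νi₁ νGi)⁻¹ hκi0,
    Measure.smul_apply, Measure.smul_apply, ENNReal.smul_def, ENNReal.smul_def] at main
  exact (ENNReal.mul_right_inj (ENNReal.coe_ne_zero.2 hκi0) ENNReal.coe_ne_top).1 main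

end Frame

end Literature.NumberTheory.Rogawski1990

end
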